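import Literature.MathematicalPhysics.QuantumFieldTheory.Balaban1983to89.B1Eq324BenfattoKernelSect5PartFieldRows
import HarnessLib

/-!
# `Balaban1983to89.B1Eq324BenfattoKernelSect5UnionCentreRows` — [BenfattoEtAl1978] §5 (5.16)–(5.18), (5.30) pp. 156–158, Appendix C (C.7)–(C.8)
# p. 164 for the class of [Balaban1985BackgroundPropagators] Sect. E p. 428: THE CENTRE ROWS FOR THE UNION CONDITIONING `Γ := C ∪ Γ₁` of the
# (4.6)-side — the conditional mean of the class field given a γb-small datum on the corridors AND a b-small datum on a far conditioning set `C`,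
# on the region, on the boxes and deep inside the boxes, PROVED

statement-level skeleton of published theorems with citation tags; proofs where landed; nothing here is a claim about the
Yang–Mills mass gap

WHY THIS MODULE (cell `pub-ymgap`, seat `dag-n08-d` gen 13, CLAIM-63 = seat n08-c gen 31's «ADAPTER WANTED (union-centre rows)» of 2026-08-28T09:38Z,
the (t2) trigger of seat n08-w5's `…KernelSect5PartFieldRows`; node N08 [Balaban1985UV3]; the [BenfattoEtAl1978] source chain behind the (α)-row `h324`).
The (4.6)-side steps of the class port (`…KernelSect5Eq536`, `…KernelSect5UpperStep`, `…KernelSect5PavementChainUpper`) condition on `Γ := C ∪ Γ₁`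
(`Γ₁ = corridors L w B`, `C` print's conditioning set of (4.6)) and integrate data `ξ` that are `γb(1 + d(·, I))`-small on `Γ₁` and only
`b(1 + d(·, I))`-small on `C` (the two events of `upperPavementChainCond`).  The cluster side's per-box rows (c), (d), (f) of seat n08-c's
`…KernelSect5PerBoxAtPavement` are about the centre `condMean K Γ ξ`; seat n08-w5 discharged them for `Γ = Γ₁`.  Here they are discharged for the
UNION, for sites FAR from `C` (`dist x c ≥ R` for `c ∈ C` — print's `C` is at distance `b³` from `J`, Lemma p. 152): ONE mechanism, n08-w5's DECAYING
F5 `abs_condMean_le_sum_exp` (general `Γ`), the boundary sum split into its corridor part (datum `γb`-small, distance `≥ t₀`, `t₀ = 0` on the box,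
`t₀ = w − v` deep inside) and its `C`-part (datum `b`-small, distance `≥ R`), the profile `d(·, I)` being 1-Lipschitz for `dist ≥ |·−·|₂`; the
quarter-rate growth row `V₄` absorbs both parts (`e^{−(θ/2)t} ≤ e^{−(θ/4)t₀}e^{−(θ/4)t}`).

WHAT IS PROVED (standard axioms; no `sorry`; no definition).
* ★★ `abs_condMean_union_le_of_far` (CORE): `Γ₁, C ⊆ Λ`, `x ∈ Λ − (C ∪ Γ₁)` with `dist x c ≥ R` on `C` and `≥ t₀` on `Γ₁`, data as above (`γ, b ≥ 0`):
  `|condMean K (C ∪ Γ₁) ξ x| ≤ (M₂V₄/(γ_A − J))·(γe^{−(θ/4)t₀} + e^{−(θ/4)R})·b·(1 + d(x, I))`.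
* ★★ (f′) `abs_condMean_union_le_profile_on_shrink` — on `shrink L m w` (boxes disjoint from `C`): `≤ (M₂V₄/(γ_A − J))·(γ + e^{−(θ/4)R})·b·(1 + d(x, I))`.
* ★★ (d′) `abs_condMean_union_le_deep` — on `shrink L m (w + (w − v))`, tessera meeting `I`:
  `≤ (M₂V₄/(γ_A − J))·(γe^{−(θ/4)(w−v)} + e^{−(θ/4)R})·b·(1 + √d(L − 1))`.
* ★★ (c′) `abs_condMean_union_le_on_region` — on `I` off `C` (`Λ ≠ ∅`): `≤ γb + (M₂V₄/(γ_A − J))·(γ + e^{−(θ/4)R})·b`.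
HONEST SCOPE.  A row-discharge module by name over seat n08-w5's decaying F5 and the §5 geometry; constants `(γ_A, J, θ, M₂, V₄)` of the class for a
pseudometric `dist ≥ |·−·|₂` (take `dist := |·−·|₂`); the class and its rows are OURS, not print's; nothing of [Balaban1985UV3] / [Balaban1985UV2] is
asserted; NO generalised Basic Lemma is stated; the port is not commissioned; count-neutral for N08; nothing about d = 4, the continuum, OS axioms,
a mass gap or the Clay problem.
-/

noncomputable section

open Finset Matrix
open scoped BigOperators

namespace Literature.MathematicalPhysics.QuantumFieldTheory.Balaban1983to89.B1Eq324BenfattoKernelSect5UnionCentreRows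

open Literature.MathematicalPhysics.QuantumFieldTheory
open Literature.MathematicalPhysics.QuantumFieldTheory.Balaban1983to89.B1Eq324BenfattoLemma
open Literature.MathematicalPhysics.QuantumFieldTheory.Balaban1983to89.B1Eq324BenfattoAppendixA (cubeDist_nonneg distToRegion_nonneg)
open Literature.MathematicalPhysics.QuantumFieldTheory.Balaban1983to89.B1Eq324BenfattoSect5Boxes
open Literature.MathematicalPhysics.QuantumFieldTheory.Balaban1983to89.B1Eq324BenfattoSect5SlotMoments (distToRegion_eq_zero_of_mem cubeDist_self)
open Literature.MathematicalPhysics.QuantumFieldTheory.Balaban1983to89.B1Eq324BenfattoSect5Eq515 (smallFieldOn)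
open Literature.MathematicalPhysics.QuantumFieldTheory.Balaban1983to89.B1Eq324BenfattoSect5Eq524 (le_cubeDist_of_mem_shrink_of_not_mem_shrink)
open Literature.MathematicalPhysics.QuantumFieldTheory.Balaban1983to89.B1Eq324BenfattoCondCentre (condMean_apply_of_mem)
open Literature.MathematicalPhysics.QuantumFieldTheory.Balaban1983to89.B1Eq324BenfattoClassAppendixC (posDef_of_coercive)
open Literature.MathematicalPhysics.QuantumFieldTheory.Balaban1983to89.B1Eq324BenfattoKernelOfPrecision
open Literature.MathematicalPhysics.QuantumFieldTheory.Balaban1983to89.B1Eq324BenfattoKernelSect5PartFieldRows (abs_condMean_le_sum_exp)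
open Literature.MathematicalPhysics.QuantumFieldTheory.Balaban1983to89.B1Eq324BenfattoClassCrossRowMassMoment
  (abs_distToRegion_sub_distToRegion_le_sqrt cubeDist_le_sqrt_sum_sq distToRegion_le_cubeDist_add_of_box_meets)

variable {d : ℕ}

section Union

variable {Λ : Finset (B1Eq324BenfattoLemma.Site d)} {A : Matrix Λ Λ ℝ}
  {K : B1Eq324BenfattoLemma.Site d → B1Eq324BenfattoLemma.Site d → ℝ}
  (hK : ∀ x y, K x y = if h : x ∈ Λ ∧ y ∈ Λ then (A⁻¹ : Matrix Λ Λ ℝ) ⟨x, h.1⟩ ⟨y, h.2⟩ else 0)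
  {L w v : ℕ} {B C I : Finset (B1Eq324BenfattoLemma.Site d)} {γ b : ℝ}

include hK

omit hK in
/-- kernel: the profile `d(Δ_·, I)` is 1-Lipschitz for any weight dominating `|·−·|₂`, in product form:
`1 + d(c, I) ≤ (1 + d(x, I))(1 + dist x c)`. [folklore] -/
private theorem one_add_distToRegion_le_mul {dist : B1Eq324BenfattoLemma.Site d → B1Eq324BenfattoLemma.Site d → ℝ}
    (hl2 : ∀ x y : B1Eq324BenfattoLemma.Site d, Real.sqrt (∑ j, (((x j : ℝ) - (y j : ℝ))) ^ 2) ≤ dist x y)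
    (I : Finset (B1Eq324BenfattoLemma.Site d)) (x c : B1Eq324BenfattoLemma.Site d) :
    1 + distToRegion I c ≤ (1 + distToRegion I x) * (1 + dist x c) := by
  have h := (abs_sub_le_iff.mp (abs_distToRegion_sub_distToRegion_le_sqrt I c x)).1
  have hsymm : Real.sqrt (∑ j, (((c j : ℝ) - (x j : ℝ))) ^ 2) = Real.sqrt (∑ j, (((x j : ℝ) - (c j : ℝ))) ^ 2) := by
    congr 1
    exact Finset.sum_congr rfl fun j _ => by ring
  rw [hsymm] at h
  have hdc : 0 ≤ dist x c := (Real.sqrt_nonneg _).trans (hl2 x c)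
  have hdx : 0 ≤ distToRegion I x := distToRegion_nonneg I x
  nlinarith [hl2 x c]

omit hK in
/-- kernel: `e^{−(θ/2)t} ≤ e^{−(θ/4)s}·e^{−(θ/4)t}` for `s ≤ t`, `θ ≥ 0`. [folklore] -/
private theorem exp_half_le_exp_quarter_mul {θ s t : ℝ} (hθ : 0 ≤ θ) (hst : s ≤ t) :
    Real.exp (-(θ / 2 * t)) ≤ Real.exp (-(θ / 4 * s)) * Real.exp (-(θ / 4 * t)) := by
  rw [← Real.exp_add, Real.exp_le_exp]
  nlinarith

/-- ★★ **THE CORE ROW — the centre for the union conditioning at a site far from `C`**: for the class kernel `hK` (`A` symmetric, `γ_A`-coercive,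
Combes–Thomas row `J < γ_A` at rate `θ ≥ 0` for a pseudometric `dist ≥ |·−·|₂`, half-rate weighted row `M₂`, quarter-rate growth row `V₄`),
`C, Γ₁ ⊆ Λ` (`Γ₁ = corridors L w B`), a datum `ξ` with `|ξ_c| ≤ γb(1 + d(c, I))` on `Γ₁` and `|ξ_c| ≤ b(1 + d(c, I))` on `C` (`γ, b ≥ 0`), and a site
`x ∈ Λ − (C ∪ Γ₁)` with `dist x c ≥ R` for `c ∈ C` and `dist x c ≥ t₀` for `c ∈ Γ₁`:
`|condMean K (C ∪ Γ₁) ξ x| ≤ (M₂V₄/(γ_A − J))·(γe^{−(θ/4)t₀} + e^{−(θ/4)R})·b·(1 + d(x, I))` — n08-w5's decaying F5 with the boundary sum split into its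
corridor part and its `C`-part. [cite: BenfattoEtAl1978, §5 (5.16)–(5.18) p.156, (5.30) p.158, Appendix C (C.7)–(C.8) p.164 (class form; ours); Lemma p.152 «at distance b³ from J»] -/
theorem abs_condMean_union_le_of_far
    (hAs : ∀ e e', A e e' = A e' e) {γA : ℝ} (hγA0 : 0 < γA)
    (hγA : ∀ x : Λ → ℝ, γA * ∑ e, x e ^ 2 ≤ ∑ e, ∑ e', A e e' * x e * x e')
    {dist : B1Eq324BenfattoLemma.Site d → B1Eq324BenfattoLemma.Site d → ℝ}
    (hd0 : ∀ e, dist e e = 0) (hdsymm : ∀ e e', dist e e' = dist e' e) (hdtri : ∀ e e' e'', dist e e'' ≤ dist e e' + dist e' e'')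
    {J θ : ℝ}
    (hJ : ∀ e : Λ, ∑ e' : Λ, |A e e'| * (Real.cosh (θ * dist (e : B1Eq324BenfattoLemma.Site d) (e' : B1Eq324BenfattoLemma.Site d)) - 1) ≤ J)
    (hθ : 0 ≤ θ) (hJγ : J < γA)
    (hl2 : ∀ x y : B1Eq324BenfattoLemma.Site d, Real.sqrt (∑ j, (((x j : ℝ) - (y j : ℝ))) ^ 2) ≤ dist x y)
    {M₂ : ℝ}
    (hM₂ : ∀ e : Λ, ∑ e' : Λ, |A e e'| * Real.exp (θ / 2 * dist (e : B1Eq324BenfattoLemma.Site d) (e' : B1Eq324BenfattoLemma.Site d)) ≤ M₂)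
    {V₄ : ℝ}
    (hV₄ : ∀ e : Λ, ∑ e' : Λ, Real.exp (-(θ / 4 * dist (e : B1Eq324BenfattoLemma.Site d) (e' : B1Eq324BenfattoLemma.Site d))) *
      (1 + dist (e : B1Eq324BenfattoLemma.Site d) (e' : B1Eq324BenfattoLemma.Site d)) ≤ V₄)
    (hCΛ : C ⊆ Λ) (hΓΛ : corridors L w B ⊆ Λ) (hγ0 : 0 ≤ γ) (hb0 : 0 ≤ b)
    (ξ : B1Eq324BenfattoLemma.Site d → ℝ) (hξΓ : ∀ c ∈ corridors L w B, |ξ c| ≤ γ * b * (1 + distToRegion I c))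
    (hξC : ∀ c ∈ C, |ξ c| ≤ b * (1 + distToRegion I c))
    {x : B1Eq324BenfattoLemma.Site d} (hx : x ∈ Λ) (hxΓ : x ∉ C ∪ corridors L w B) {R t₀ : ℝ}
    (hR : ∀ c ∈ C, R ≤ dist x c) (ht₀ : ∀ c ∈ corridors L w B, t₀ ≤ dist x c) :
    |condMean K (C ∪ corridors L w B) ξ x| ≤
      M₂ * V₄ / (γA - J) * (γ * Real.exp (-(θ / 4 * t₀)) + Real.exp (-(θ / 4 * R))) * b * (1 + distToRegion I x) := by
  classical
  have hγJ : 0 < γA - J := by linarith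
  have hM0 : 0 ≤ M₂ := le_trans (Finset.sum_nonneg fun e' _ => mul_nonneg (abs_nonneg _) (Real.exp_pos _).le) (hM₂ ⟨x, hx⟩)
  have hC0 : 0 ≤ M₂ / (γA - J) := div_nonneg hM0 hγJ.le
  have hP0 : 0 ≤ 1 + distToRegion I x := by linarith [distToRegion_nonneg I x]
  set Φ : ℝ := γ * Real.exp (-(θ / 4 * t₀)) + Real.exp (-(θ / 4 * R)) with hΦ
  have hΦ1 : γ * Real.exp (-(θ / 4 * t₀)) ≤ Φ := by rw [hΦ]; linarith [Real.exp_pos (-(θ / 4 * R))]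
  have hΦ2 : Real.exp (-(θ / 4 * R)) ≤ Φ := by
    rw [hΦ]; linarith [mul_nonneg hγ0 (Real.exp_pos (-(θ / 4 * t₀))).le]
  have hΦ0 : 0 ≤ Φ := (Real.exp_pos _).le.trans hΦ2
  set S : Finset ↥Λ := (C ∪ corridors L w B).subtype (· ∈ Λ) with hS
  -- each boundary term
  have hterm : ∀ c : ↥S,
      Real.exp (-(θ / 2 * dist x ((c : Λ) : B1Eq324BenfattoLemma.Site d))) * |ξ ((c : Λ) : B1Eq324BenfattoLemma.Site d)| ≤
        b * Φ * (1 + distToRegion I x) *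
          (Real.exp (-(θ / 4 * dist x ((c : Λ) : B1Eq324BenfattoLemma.Site d))) * (1 + dist x ((c : Λ) : B1Eq324BenfattoLemma.Site d))) := by
    intro c
    have hcU : ((c : Λ) : B1Eq324BenfattoLemma.Site d) ∈ C ∪ corridors L w B := Finset.mem_subtype.mp c.2
    have hdc : 0 ≤ dist x ((c : Λ) : B1Eq324BenfattoLemma.Site d) := (Real.sqrt_nonneg _).trans (hl2 _ _)
    have hlip := one_add_distToRegion_le_mul hl2 I x ((c : Λ) : B1Eq324BenfattoLemma.Site d)
    have hE0 : 0 ≤ Real.exp (-(θ / 4 * dist x ((c : Λ) : B1Eq324BenfattoLemma.Site d))) * (1 + dist x ((c : Λ) : B1Eq324BenfattoLemma.Site d)) :=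
      mul_nonneg (Real.exp_pos _).le (by linarith)
    by_cases hcΓ : ((c : Λ) : B1Eq324BenfattoLemma.Site d) ∈ corridors L w B
    · -- corridor part: datum `γb`-small, distance `≥ t₀`
      have hξc : |ξ ((c : Λ) : B1Eq324BenfattoLemma.Site d)| ≤ γ * b * ((1 + distToRegion I x) * (1 + dist x ((c : Λ) : B1Eq324BenfattoLemma.Site d))) :=
        (hξΓ _ hcΓ).trans (mul_le_mul_of_nonneg_left hlip (mul_nonneg hγ0 hb0))
      have hex := exp_half_le_exp_quarter_mul hθ (ht₀ _ hcΓ) (t := dist x ((c : Λ) : B1Eq324BenfattoLemma.Site d))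
      calc Real.exp (-(θ / 2 * dist x ((c : Λ) : B1Eq324BenfattoLemma.Site d))) * |ξ ((c : Λ) : B1Eq324BenfattoLemma.Site d)|
          ≤ (Real.exp (-(θ / 4 * t₀)) * Real.exp (-(θ / 4 * dist x ((c : Λ) : B1Eq324BenfattoLemma.Site d)))) *
              (γ * b * ((1 + distToRegion I x) * (1 + dist x ((c : Λ) : B1Eq324BenfattoLemma.Site d)))) :=
            mul_le_mul hex hξc (abs_nonneg _) (by positivity)
        _ = (γ * Real.exp (-(θ / 4 * t₀))) * (b * (1 + distToRegion I x) *
              (Real.exp (-(θ / 4 * dist x ((c : Λ) : B1Eq324BenfattoLemma.Site d))) * (1 + dist x ((c : Λ) : B1Eq324BenfattoLemma.Site d)))) := by ring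
        _ ≤ Φ * (b * (1 + distToRegion I x) *
              (Real.exp (-(θ / 4 * dist x ((c : Λ) : B1Eq324BenfattoLemma.Site d))) * (1 + dist x ((c : Λ) : B1Eq324BenfattoLemma.Site d)))) :=
            mul_le_mul_of_nonneg_right hΦ1 (mul_nonneg (mul_nonneg hb0 hP0) hE0)
        _ = _ := by ring
    · -- `C`-part: datum `b`-small, distance `≥ R`
      have hcC : ((c : Λ) : B1Eq324BenfattoLemma.Site d) ∈ C := (Finset.mem_union.mp hcU).resolve_right hcΓ
      have hξc : |ξ ((c : Λ) : B1Eq324BenfattoLemma.Site d)| ≤ b * ((1 + distToRegion I x) * (1 + dist x ((c : Λ) : B1Eq324BenfattoLemma.Site d))) :=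
        (hξC _ hcC).trans (mul_le_mul_of_nonneg_left hlip hb0)
      have hex := exp_half_le_exp_quarter_mul hθ (hR _ hcC) (t := dist x ((c : Λ) : B1Eq324BenfattoLemma.Site d))
      calc Real.exp (-(θ / 2 * dist x ((c : Λ) : B1Eq324BenfattoLemma.Site d))) * |ξ ((c : Λ) : B1Eq324BenfattoLemma.Site d)|
          ≤ (Real.exp (-(θ / 4 * R)) * Real.exp (-(θ / 4 * dist x ((c : Λ) : B1Eq324BenfattoLemma.Site d)))) *
              (b * ((1 + distToRegion I x) * (1 + dist x ((c : Λ) : B1Eq324BenfattoLemma.Site d)))) :=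
            mul_le_mul hex hξc (abs_nonneg _) (by positivity)
        _ = Real.exp (-(θ / 4 * R)) * (b * (1 + distToRegion I x) *
              (Real.exp (-(θ / 4 * dist x ((c : Λ) : B1Eq324BenfattoLemma.Site d))) * (1 + dist x ((c : Λ) : B1Eq324BenfattoLemma.Site d)))) := by ring
        _ ≤ Φ * (b * (1 + distToRegion I x) *
              (Real.exp (-(θ / 4 * dist x ((c : Λ) : B1Eq324BenfattoLemma.Site d))) * (1 + dist x ((c : Λ) : B1Eq324BenfattoLemma.Site d)))) :=
            mul_le_mul_of_nonneg_right hΦ2 (mul_nonneg (mul_nonneg hb0 hP0) hE0)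
        _ = _ := by ring
  -- the boundary sum against the quarter-rate growth row at `x`
  have hrow : ∑ c : ↥S, Real.exp (-(θ / 4 * dist x ((c : Λ) : B1Eq324BenfattoLemma.Site d))) * (1 + dist x ((c : Λ) : B1Eq324BenfattoLemma.Site d)) ≤ V₄ := by
    have h2 : ∑ c : ↥S, Real.exp (-(θ / 4 * dist x ((c : Λ) : B1Eq324BenfattoLemma.Site d))) * (1 + dist x ((c : Λ) : B1Eq324BenfattoLemma.Site d)) ≤
        ∑ e' : ↥Λ, Real.exp (-(θ / 4 * dist x (e' : B1Eq324BenfattoLemma.Site d))) * (1 + dist x (e' : B1Eq324BenfattoLemma.Site d)) := by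
      rw [Finset.sum_coe_sort S (fun e' : ↥Λ => Real.exp (-(θ / 4 * dist x (e' : B1Eq324BenfattoLemma.Site d))) * (1 + dist x (e' : B1Eq324BenfattoLemma.Site d)))]
      exact Finset.sum_le_univ_sum_of_nonneg fun e' => mul_nonneg (Real.exp_pos _).le
        (by linarith [(Real.sqrt_nonneg _).trans (hl2 x (e' : B1Eq324BenfattoLemma.Site d))])
    exact h2.trans (hV₄ ⟨x, hx⟩)
  have hsum : ∑ c : ↥S, Real.exp (-(θ / 2 * dist x ((c : Λ) : B1Eq324BenfattoLemma.Site d))) * |ξ ((c : Λ) : B1Eq324BenfattoLemma.Site d)| ≤ b * Φ * (1 + distToRegion I x) * V₄ := by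
    calc ∑ c : ↥S, Real.exp (-(θ / 2 * dist x ((c : Λ) : B1Eq324BenfattoLemma.Site d))) * |ξ ((c : Λ) : B1Eq324BenfattoLemma.Site d)|
        ≤ ∑ c : ↥S, b * Φ * (1 + distToRegion I x) * (Real.exp (-(θ / 4 * dist x ((c : Λ) : B1Eq324BenfattoLemma.Site d))) * (1 + dist x ((c : Λ) : B1Eq324BenfattoLemma.Site d))) :=
          Finset.sum_le_sum fun c _ => hterm c
      _ = b * Φ * (1 + distToRegion I x) * ∑ c : ↥S, Real.exp (-(θ / 4 * dist x ((c : Λ) : B1Eq324BenfattoLemma.Site d))) * (1 + dist x ((c : Λ) : B1Eq324BenfattoLemma.Site d)) := by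
          rw [Finset.mul_sum]
      _ ≤ b * Φ * (1 + distToRegion I x) * V₄ :=
          mul_le_mul_of_nonneg_left hrow (mul_nonneg (mul_nonneg hb0 hΦ0) hP0)
  have hmain := abs_condMean_le_sum_exp hK hAs hγA0 hγA hd0 hdsymm hdtri hJ hθ hJγ hl2 hM₂ (Finset.union_subset hCΛ hΓΛ) ξ hx hxΓ
  calc |condMean K (C ∪ corridors L w B) ξ x|
      ≤ M₂ / (γA - J) * ∑ c : ↥S, Real.exp (-(θ / 2 * dist x ((c : Λ) : B1Eq324BenfattoLemma.Site d))) * |ξ ((c : Λ) : B1Eq324BenfattoLemma.Site d)| := hmain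
    _ ≤ M₂ / (γA - J) * (b * Φ * (1 + distToRegion I x) * V₄) := mul_le_mul_of_nonneg_left hsum hC0
    _ = M₂ * V₄ / (γA - J) * Φ * b * (1 + distToRegion I x) := by ring

/-- ★★ **ROW (f′) — the union centre on a box of the pavement**: for `m ∈ B` with the box inside `Λ`, boxes' `shrink L m w` disjoint from `C`, data
`ξ ∈ χ^{Γ₁}_{γb} ∩ χ^{C}_{b}` (S8b's two events) and `x ∈ shrink L m w` with `dist x c ≥ R` on `C`:
`|condMean K (C ∪ Γ₁) ξ x| ≤ (M₂V₄/(γ_A − J))·(γ + e^{−(θ/4)R})·b·(1 + d(x, I))` — the core row at `t₀ = 0`.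
[cite: BenfattoEtAl1978, §5 (5.16) p.156, Appendix C (C.8) p.164, Lemma 2 p.165 (class form; ours)] -/
theorem abs_condMean_union_le_profile_on_shrink
    (hAs : ∀ e e', A e e' = A e' e) {γA : ℝ} (hγA0 : 0 < γA)
    (hγA : ∀ x : Λ → ℝ, γA * ∑ e, x e ^ 2 ≤ ∑ e, ∑ e', A e e' * x e * x e')
    {dist : B1Eq324BenfattoLemma.Site d → B1Eq324BenfattoLemma.Site d → ℝ}
    (hd0 : ∀ e, dist e e = 0) (hdsymm : ∀ e e', dist e e' = dist e' e) (hdtri : ∀ e e' e'', dist e e'' ≤ dist e e' + dist e' e'')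
    {J θ : ℝ}
    (hJ : ∀ e : Λ, ∑ e' : Λ, |A e e'| * (Real.cosh (θ * dist (e : B1Eq324BenfattoLemma.Site d) (e' : B1Eq324BenfattoLemma.Site d)) - 1) ≤ J)
    (hθ : 0 ≤ θ) (hJγ : J < γA)
    (hl2 : ∀ x y : B1Eq324BenfattoLemma.Site d, Real.sqrt (∑ j, (((x j : ℝ) - (y j : ℝ))) ^ 2) ≤ dist x y)
    {M₂ : ℝ}
    (hM₂ : ∀ e : Λ, ∑ e' : Λ, |A e e'| * Real.exp (θ / 2 * dist (e : B1Eq324BenfattoLemma.Site d) (e' : B1Eq324BenfattoLemma.Site d)) ≤ M₂)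
    {V₄ : ℝ}
    (hV₄ : ∀ e : Λ, ∑ e' : Λ, Real.exp (-(θ / 4 * dist (e : B1Eq324BenfattoLemma.Site d) (e' : B1Eq324BenfattoLemma.Site d))) *
      (1 + dist (e : B1Eq324BenfattoLemma.Site d) (e' : B1Eq324BenfattoLemma.Site d)) ≤ V₄)
    (hL : 0 < L) (hBΛ : ∀ m ∈ B, box L m ⊆ Λ) (hCΛ : C ⊆ Λ) (hΓΛ : corridors L w B ⊆ Λ)
    (hdisj : ∀ m ∈ B, Disjoint (shrink L m w) C) (hγ0 : 0 ≤ γ) (hb0 : 0 ≤ b) {R : ℝ} :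
    ∀ m ∈ B, ∀ ξ ∈ smallFieldOn (corridors L w B : Set (B1Eq324BenfattoLemma.Site d)) I (γ * b), ξ ∈ smallFieldOn (C : Set (B1Eq324BenfattoLemma.Site d)) I b →
      ∀ x ∈ shrink L m w, (∀ c ∈ C, R ≤ dist x c) →
        |condMean K (C ∪ corridors L w B) ξ x| ≤
          M₂ * V₄ / (γA - J) * (γ + Real.exp (-(θ / 4 * R))) * b * (1 + distToRegion I x) := by
  intro m hm ξ hξΓ hξC x hx hR
  have hxΛ : x ∈ Λ := hBΛ m hm (shrink_subset_box L m w hx)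
  have hxΓ : x ∉ C ∪ corridors L w B := by
    intro h
    rcases Finset.mem_union.mp h with hC | hΓ
    · exact Finset.disjoint_left.mp (hdisj m hm) hx hC
    · exact Finset.disjoint_left.mp (disjoint_corridors_shrink hL w B m) hΓ hx
  have h := abs_condMean_union_le_of_far hK hAs hγA0 hγA hd0 hdsymm hdtri hJ hθ hJγ hl2 hM₂ hV₄ hCΛ hΓΛ hγ0 hb0 ξ
    (fun c hc => hξΓ c (Finset.mem_coe.mpr hc)) (fun c hc => hξC c (Finset.mem_coe.mpr hc)) hxΛ hxΓ hR
    (t₀ := 0) (fun c _ => by simpa using (Real.sqrt_nonneg _).trans (hl2 x c))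
  simpa only [mul_zero, neg_zero, Real.exp_zero, mul_one] using h

/-- ★★ **ROW (d′) — deep inside the box the union centre is small**: for `m ∈ B` whose tessera meets `I`, boxes' `shrink L m w` disjoint from `C`,
data `ξ ∈ χ^{Γ₁}_{γb} ∩ χ^{C}_{b}` and `x ∈ shrink L m (w + (w − v))` with `dist x c ≥ R` on `C`:
`|condMean K (C ∪ Γ₁) ξ x| ≤ (M₂V₄/(γ_A − J))·(γe^{−(θ/4)(w−v)} + e^{−(θ/4)R})·b·(1 + √d(L − 1))` — the core row at `t₀ = w − v` (every corridor site lies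
outside `shrink L m w`, hence at cube distance `≥ w − v` from the deep sites) with `d(x, I) ≤ √d(L − 1)` inside a tessera meeting `I`; the first
summand is n08-w5's row (d) constant up to the letters `V, M ↦ M₂, V₄`. [cite: BenfattoEtAl1978, §5 (5.30)–(5.31) p.158, Appendix C (C.8) p.164 (class form; ours)] -/
theorem abs_condMean_union_le_deep
    (hAs : ∀ e e', A e e' = A e' e) {γA : ℝ} (hγA0 : 0 < γA)
    (hγA : ∀ x : Λ → ℝ, γA * ∑ e, x e ^ 2 ≤ ∑ e, ∑ e', A e e' * x e * x e')
    {dist : B1Eq324BenfattoLemma.Site d → B1Eq324BenfattoLemma.Site d → ℝ}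
    (hd0 : ∀ e, dist e e = 0) (hdsymm : ∀ e e', dist e e' = dist e' e) (hdtri : ∀ e e' e'', dist e e'' ≤ dist e e' + dist e' e'')
    {J θ : ℝ}
    (hJ : ∀ e : Λ, ∑ e' : Λ, |A e e'| * (Real.cosh (θ * dist (e : B1Eq324BenfattoLemma.Site d) (e' : B1Eq324BenfattoLemma.Site d)) - 1) ≤ J)
    (hθ : 0 ≤ θ) (hJγ : J < γA)
    (hl2 : ∀ x y : B1Eq324BenfattoLemma.Site d, Real.sqrt (∑ j, (((x j : ℝ) - (y j : ℝ))) ^ 2) ≤ dist x y)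
    {M₂ : ℝ}
    (hM₂ : ∀ e : Λ, ∑ e' : Λ, |A e e'| * Real.exp (θ / 2 * dist (e : B1Eq324BenfattoLemma.Site d) (e' : B1Eq324BenfattoLemma.Site d)) ≤ M₂)
    {V₄ : ℝ}
    (hV₄ : ∀ e : Λ, ∑ e' : Λ, Real.exp (-(θ / 4 * dist (e : B1Eq324BenfattoLemma.Site d) (e' : B1Eq324BenfattoLemma.Site d))) *
      (1 + dist (e : B1Eq324BenfattoLemma.Site d) (e' : B1Eq324BenfattoLemma.Site d)) ≤ V₄)
    (hL : 0 < L) (hBΛ : ∀ m ∈ B, box L m ⊆ Λ) (hCΛ : C ⊆ Λ) (hΓΛ : corridors L w B ⊆ Λ)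
    (hdisj : ∀ m ∈ B, Disjoint (shrink L m w) C) (hγ0 : 0 ≤ γ) (hb0 : 0 ≤ b) {R : ℝ} :
    ∀ m ∈ B, (∃ x ∈ box L m, x ∈ I) →
      ∀ ξ ∈ smallFieldOn (corridors L w B : Set (B1Eq324BenfattoLemma.Site d)) I (γ * b), ξ ∈ smallFieldOn (C : Set (B1Eq324BenfattoLemma.Site d)) I b →
      ∀ x ∈ shrink L m (w + (w - v)), (∀ c ∈ C, R ≤ dist x c) →
        |condMean K (C ∪ corridors L w B) ξ x| ≤
          M₂ * V₄ / (γA - J) * (γ * Real.exp (-(θ / 4 * ((w - v : ℕ) : ℝ))) + Real.exp (-(θ / 4 * R))) * b *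
            (1 + Real.sqrt d * ((L : ℝ) - 1)) := by
  intro m hm hmI ξ hξΓ hξC x hx hR
  have hγJ : 0 < γA - J := by linarith
  have hxw : x ∈ shrink L m w := shrink_mono L m (Nat.le_add_right w (w - v)) hx
  have hxbox : x ∈ box L m := shrink_subset_box L m w hxw
  have hxΛ : x ∈ Λ := hBΛ m hm hxbox
  have hxΓ : x ∉ C ∪ corridors L w B := by
    intro h
    rcases Finset.mem_union.mp h with hC | hΓ
    · exact Finset.disjoint_left.mp (hdisj m hm) hxw hC
    · exact Finset.disjoint_left.mp (disjoint_corridors_shrink hL w B m) hΓ hxw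
  have ht₀ : ∀ c ∈ corridors L w B, ((w - v : ℕ) : ℝ) ≤ dist x c := fun c hc => by
    have hcw : c ∉ shrink L m w := fun h => Finset.disjoint_left.mp (disjoint_corridors_shrink hL w B m) hc h
    exact ((le_cubeDist_of_mem_shrink_of_not_mem_shrink hx hcw).trans (cubeDist_le_sqrt_sum_sq x c)).trans (hl2 x c)
  have h := abs_condMean_union_le_of_far hK hAs hγA0 hγA hd0 hdsymm hdtri hJ hθ hJγ hl2 hM₂ hV₄ hCΛ hΓΛ hγ0 hb0 ξ
    (fun c hc => hξΓ c (Finset.mem_coe.mpr hc)) (fun c hc => hξC c (Finset.mem_coe.mpr hc)) hxΛ hxΓ hR ht₀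
  -- `d(Δ_x, I) ≤ √d(L − 1)`
  obtain ⟨xI, hxI, hxII⟩ := hmI
  have hdx : distToRegion I x ≤ Real.sqrt d * ((L : ℝ) - 1) := by
    have h' := distToRegion_le_cubeDist_add_of_box_meets hL hxbox hxI hxII x
    rw [cubeDist_self, zero_add] at h'
    exact h'
  have hM0 : 0 ≤ M₂ := le_trans (Finset.sum_nonneg fun e' _ => mul_nonneg (abs_nonneg _) (Real.exp_pos _).le) (hM₂ ⟨x, hxΛ⟩)
  have hV0 : 0 ≤ V₄ := le_trans (Finset.sum_nonneg fun e' _ => mul_nonneg (Real.exp_pos _).le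
    (by linarith [(Real.sqrt_nonneg _).trans (hl2 ((⟨x, hxΛ⟩ : Λ) : B1Eq324BenfattoLemma.Site d) (e' : B1Eq324BenfattoLemma.Site d))])) (hV₄ ⟨x, hxΛ⟩)
  have hcoef : 0 ≤ M₂ * V₄ / (γA - J) * (γ * Real.exp (-(θ / 4 * ((w - v : ℕ) : ℝ))) + Real.exp (-(θ / 4 * R))) * b :=
    mul_nonneg (mul_nonneg (div_nonneg (mul_nonneg hM0 hV0) hγJ.le)
      (add_nonneg (mul_nonneg hγ0 (Real.exp_pos _).le) (Real.exp_pos _).le)) hb0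
  exact h.trans (mul_le_mul_of_nonneg_left (by linarith) hcoef)

/-- ★★ **ROW (c′) — the union centre on the region `I`, off `C`** (`Λ ≠ ∅`): for data `ξ ∈ χ^{Γ₁}_{γb} ∩ χ^{C}_{b}` and every `y ∈ I ∖ C` with
`dist y c ≥ R` on `C`: `|condMean K (C ∪ Γ₁) ξ y| ≤ γb + (M₂V₄/(γ_A − J))·(γ + e^{−(θ/4)R})·b` — off `Λ` the centre vanishes
(`condMean_kernel_eq_zero_of_not_mem`), on `Γ₁` it reproduces the datum (`condMean_apply_of_mem`, `|ξ_y| ≤ γb` as `d(y, I) = 0`), on `Λ ∖ (C ∪ Γ₁)`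
the core row at `t₀ = 0`, `d(y, I) = 0`.  (On `C ∩ I` the centre IS `ξ`, only `b`-small — excluded.)
[cite: BenfattoEtAl1978, §5 (5.16)–(5.18) p.156, Appendix C (C.7)–(C.8) p.164 (class form; ours)] -/
theorem abs_condMean_union_le_on_region
    (hAs : ∀ e e', A e e' = A e' e) {γA : ℝ} (hγA0 : 0 < γA)
    (hγA : ∀ x : Λ → ℝ, γA * ∑ e, x e ^ 2 ≤ ∑ e, ∑ e', A e e' * x e * x e')
    {dist : B1Eq324BenfattoLemma.Site d → B1Eq324BenfattoLemma.Site d → ℝ}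
    (hd0 : ∀ e, dist e e = 0) (hdsymm : ∀ e e', dist e e' = dist e' e) (hdtri : ∀ e e' e'', dist e e'' ≤ dist e e' + dist e' e'')
    {J θ : ℝ}
    (hJ : ∀ e : Λ, ∑ e' : Λ, |A e e'| * (Real.cosh (θ * dist (e : B1Eq324BenfattoLemma.Site d) (e' : B1Eq324BenfattoLemma.Site d)) - 1) ≤ J)
    (hθ : 0 ≤ θ) (hJγ : J < γA)
    (hl2 : ∀ x y : B1Eq324BenfattoLemma.Site d, Real.sqrt (∑ j, (((x j : ℝ) - (y j : ℝ))) ^ 2) ≤ dist x y)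
    {M₂ : ℝ}
    (hM₂ : ∀ e : Λ, ∑ e' : Λ, |A e e'| * Real.exp (θ / 2 * dist (e : B1Eq324BenfattoLemma.Site d) (e' : B1Eq324BenfattoLemma.Site d)) ≤ M₂)
    {V₄ : ℝ}
    (hV₄ : ∀ e : Λ, ∑ e' : Λ, Real.exp (-(θ / 4 * dist (e : B1Eq324BenfattoLemma.Site d) (e' : B1Eq324BenfattoLemma.Site d))) *
      (1 + dist (e : B1Eq324BenfattoLemma.Site d) (e' : B1Eq324BenfattoLemma.Site d)) ≤ V₄)
    (hΛ : Λ.Nonempty) (hCΛ : C ⊆ Λ) (hΓΛ : corridors L w B ⊆ Λ) (hγ0 : 0 ≤ γ) (hb0 : 0 ≤ b) {R : ℝ} :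
    ∀ ξ ∈ smallFieldOn (corridors L w B : Set (B1Eq324BenfattoLemma.Site d)) I (γ * b), ξ ∈ smallFieldOn (C : Set (B1Eq324BenfattoLemma.Site d)) I b →
      ∀ y ∈ I, y ∉ C → (∀ c ∈ C, R ≤ dist y c) →
        |condMean K (C ∪ corridors L w B) ξ y| ≤ γ * b + M₂ * V₄ / (γA - J) * (γ + Real.exp (-(θ / 4 * R))) * b := by
  classical
  intro ξ hξΓ hξC y hy hyC hR
  have hγJ : 0 < γA - J := by linarith
  obtain ⟨e₀, he₀⟩ := hΛ
  have hM0 : 0 ≤ M₂ := le_trans (Finset.sum_nonneg fun e' _ => mul_nonneg (abs_nonneg _) (Real.exp_pos _).le) (hM₂ ⟨e₀, he₀⟩)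
  have hV0 : 0 ≤ V₄ := le_trans (Finset.sum_nonneg fun e' _ => mul_nonneg (Real.exp_pos _).le
    (by linarith [(Real.sqrt_nonneg _).trans (hl2 ((⟨e₀, he₀⟩ : Λ) : B1Eq324BenfattoLemma.Site d) (e' : B1Eq324BenfattoLemma.Site d))])) (hV₄ ⟨e₀, he₀⟩)
  have hsecond : 0 ≤ M₂ * V₄ / (γA - J) * (γ + Real.exp (-(θ / 4 * R))) * b :=
    mul_nonneg (mul_nonneg (div_nonneg (mul_nonneg hM0 hV0) hγJ.le) (add_nonneg hγ0 (Real.exp_pos _).le)) hb0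
  have hγb : 0 ≤ γ * b := mul_nonneg hγ0 hb0
  have hd : distToRegion I y = 0 := distToRegion_eq_zero_of_mem hy
  by_cases hyΛ : y ∈ Λ
  · by_cases hyΓ : y ∈ corridors L w B
    · -- the centre reproduces the datum on `Γ₁`
      have hA : A.PosDef := posDef_of_coercive hAs hγA0 hγA
      rw [condMean_apply_of_mem K (C ∪ corridors L w B) ξ (isUnit_det_covGram_kernel hK hA (Finset.union_subset hCΛ hΓΛ))
        (Finset.mem_union_right C hyΓ)]
      have h1 := hξΓ y (Finset.mem_coe.mpr hyΓ)
      rw [hd, add_zero, mul_one] at h1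
      linarith
    · have hyU : y ∉ C ∪ corridors L w B := fun h => (Finset.mem_union.mp h).elim hyC hyΓ
      have h1 := abs_condMean_union_le_of_far hK hAs hγA0 hγA hd0 hdsymm hdtri hJ hθ hJγ hl2 hM₂ hV₄ hCΛ hΓΛ hγ0 hb0 ξ
        (fun c hc => hξΓ c (Finset.mem_coe.mpr hc)) (fun c hc => hξC c (Finset.mem_coe.mpr hc)) hyΛ hyU hR
        (t₀ := 0) (fun c _ => by simpa using (Real.sqrt_nonneg _).trans (hl2 y c))
      rw [hd, add_zero, mul_one, mul_zero, neg_zero, Real.exp_zero, mul_one] at h1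
      linarith
  · rw [condMean_kernel_eq_zero_of_not_mem hK (C ∪ corridors L w B) ξ hyΛ, abs_zero]
    linarith

end Union

end Literature.MathematicalPhysics.QuantumFieldTheory.Balaban1983to89.B1Eq324BenfattoKernelSect5UnionCentreRows

end
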